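import Summits.Ventures.GridStability.Lyapunov.AdmittanceWeightBounds
import Literature.MathematicalPhysics.PowerSystems.DVOCStabilityCondition
import HarnessLib

/-!
# The NO-verdict shape for [GrossEtAl2019] Condition 2: a λ₂ cap below the gain `α` makes the condition unsatisfiable

Venture GRIDFUSION, G2-SCALE cell (lead g19 §16 D34 «the Q2 verdict uses the PRINTED retrofit gains»; §19 D35 Bench
skeleton; K-A6 fork «an honest Q2 NO»), owner gridfusion-sos-5 g9. `DvocReduced.decreaseOnS_of_condition2` consumes, among
its hypotheses, a connectivity constant `λ` (`hlam : ∀ z, λ·pairNormSq z ≤ N·½ΣΣ wᵢⱼ(zᵢ − zⱼ)²`), `c ≥ 0`, voltage bounds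
`0 < vmin ≤ v* ≤ vmax`, and the node-wise Condition 2 `Σ_j w_kj|…| + α < ½(1 + cos θ̄)(vmin²/vmax²)·λ − c`. If a NO certificate
refutes `hlam(μ)` for some `0 ≤ μ ≤ α` (one test vector, `not_connectivity_certificate_of_testVector` /
`not_connectivity_certificate_admittance`), then NO choice of `λ, c, θ̄, vmin, vmax` meets those hypotheses: every admissible
`λ` is `< μ` (`lt_of_not_connectivity_certificate`), the factor `½(1 + cos θ̄)(vmin²/vmax²)` is in `[0, 1]`, and the row sums
are `≥ 0` — so the right-hand side is `< μ ≤ α ≤` the left-hand side. This is the sentence «Condition 2 (as printed, gains as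
printed) cannot be met on this network» in the tree's vocabulary; it does NOT say the dVOC network is unstable (Condition 2 is
sufficient, not necessary). THREE COLUMNS. CERTIFIED (kernel): the lemma. VALIDATED / MODELLED: nothing here; an instance
carries the feeder's MODELLED column. [cite: GrossEtAl2019, Condition 2 and Proposition 3]
-/

namespace Summit.Ventures.GridStability.Lyapunov

open Finset Real
open Literature.MathematicalPhysics.PowerSystems
open Literature.Computation.Certificates Literature.Computation.Certificates.PSD

/-- **Condition 2 is unsatisfiable under a λ-cap below `α`.** For a reduced dVOC network `W` with nonnegative weights, if
`hlam(μ)` is refuted for some `0 ≤ μ ≤ W.α`, then the hypotheses `0 ≤ c`, `hlam(λ)`, `0 < vmin ≤ v* ≤ vmax` and the node-wise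
Condition 2 of `DvocReduced.decreaseOnS_of_condition2` admit no `λ, c, θ̄, vmin, vmax`. [cite: GrossEtAl2019, Condition 2] -/
theorem condition2_unsatisfiable_of_not_connectivity {N : ℕ} [NeZero N] (W : DvocReduced N)
    (hw : ∀ k j, 0 ≤ W.w k j) (μ : ℝ) (hμ : 0 ≤ μ) (hμα : μ ≤ W.α)
    (hno : ¬ ∀ z : Fin N → ℝ, μ * pairNormSq z ≤ (N : ℝ) * (1 / 2 * ∑ i, ∑ j, W.w i j * (z i - z j) ^ 2)) :
    ¬ ∃ lam c θbar vmin vmax : ℝ,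
        0 ≤ c ∧
        (∀ z : Fin N → ℝ, lam * pairNormSq z ≤ (N : ℝ) * (1 / 2 * ∑ i, ∑ j, W.w i j * (z i - z j) ^ 2)) ∧
        0 < vmin ∧ (∀ k, vmin ≤ W.vref k) ∧ (∀ k, W.vref k ≤ vmax) ∧
        (∀ k, W.nodeGainAbs k + W.α < (1 + cos θbar) / 2 * (vmin ^ 2 / vmax ^ 2) * lam - c) := by
  rintro ⟨lam, c, θbar, vmin, vmax, hc, hlam, hvmin, hmin, hmax, hcond⟩
  have k0 : Fin N := ⟨0, Nat.pos_of_ne_zero (NeZero.ne N)⟩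
  have hA0 : 0 ≤ W.nodeGainAbs k0 :=
    Finset.sum_nonneg fun j _ => mul_nonneg (hw k0 j) (abs_nonneg _)
  have hvmax : vmin ≤ vmax := (hmin k0).trans (hmax k0)
  have hvmax0 : 0 < vmax := lt_of_lt_of_le hvmin hvmax
  have hγ0 : 0 ≤ (1 + cos θbar) / 2 * (vmin ^ 2 / vmax ^ 2) :=
    mul_nonneg (by linarith [Real.neg_one_le_cos θbar]) (by positivity)
  have hγ1 : (1 + cos θbar) / 2 * (vmin ^ 2 / vmax ^ 2) ≤ 1 := by
    have h1 : (1 + cos θbar) / 2 ≤ 1 := by linarith [Real.cos_le_one θbar]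
    have h2 : vmin ^ 2 / vmax ^ 2 ≤ 1 := by
      rw [div_le_one (by positivity)]
      exact pow_le_pow_left₀ hvmin.le hvmax 2
    calc (1 + cos θbar) / 2 * (vmin ^ 2 / vmax ^ 2) ≤ 1 * 1 :=
          mul_le_mul h1 h2 (by positivity) (by norm_num)
      _ = 1 := by norm_num
  have hlt : lam < μ := lt_of_not_connectivity_certificate W.w μ hno lam hlam
  have hk := hcond k0
  set γ : ℝ := (1 + cos θbar) / 2 * (vmin ^ 2 / vmax ^ 2) with hγ
  -- γ·λ ≤ max(λ, 0) < μ ≤ α ≤ row sum + α < γ·λ − c ≤ γ·λ: contradiction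
  rcases le_or_gt lam 0 with hneg | hpos
  · have : γ * lam ≤ 0 := mul_nonpos_of_nonneg_of_nonpos hγ0 hneg
    linarith
  · have : γ * lam ≤ lam := by nlinarith
    linarith

/-- The real admittance kernel is entrywise nonnegative. [cite: GrossEtAl2019, eq. (1)] -/
theorem admittanceKernel_nonneg (N : ℕ) (ZW : ZWRows) : ∀ i j : Fin N, 0 ≤ admittanceKernel N ZW i j := by
  intro i j
  unfold admittanceKernel admittanceRow
  induction (ZW.getD i.val []) with
  | nil => simp
  | cons p row ih =>
    rw [List.map_cons, SRow.fn_cons]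
    refine add_nonneg ?_ ih
    split_ifs
    · exact admittance_nonneg _ _
    · exact le_rfl

/-- **The Q2 NO-verdict object for a typed impedance feeder.** Impedance rows `ZW` with UPPER brackets, a test vector `v`
(`Σ v = 0`) refuting `hlam(μ)` for the brackets, and a voltage gain `α ≥ μ ≥ 0`: then for the reduced dVOC network with the
REAL admittance weights `‖Yᵢⱼ‖ = (rᵢⱼ² + xᵢⱼ²)^{-1/2}`, that `α`, and ANY `η`, set-points `v*`, angles `θ*`, the hypotheses of
`DvocReduced.decreaseOnS_of_condition2` (connectivity constant, `c ≥ 0`, voltage bounds, node-wise Condition 2) admit no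
`λ, c, θ̄, vmin, vmax`. All numeric obligations are `decide`s over `ℚ`. [cite: GrossEtAl2019, Condition 2] -/
theorem condition2_unsatisfiable_admittance {N : ℕ} [NeZero N] (ZW : ZWRows) (hup : upperCheck ZW = true)
    (hW : colsBelow N (bracketSMat ZW) = true) (v : List ℚ) (μ : ℚ) (hμ : 0 ≤ μ)
    (hsum : ((List.range N).map fun i => v.getD i 0).sum = 0)
    (htest : sparseEnergy2 N (bracketSMat ZW) v < 2 * μ * ((List.range N).map fun i => v.getD i 0 ^ 2).sum)
    (η α : ℝ) (hμα : (μ : ℝ) ≤ α) (vref θ : Fin N → ℝ) :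
    ¬ ∃ lam c θbar vmin vmax : ℝ,
        0 ≤ c ∧
        (∀ z : Fin N → ℝ, lam * pairNormSq z
          ≤ (N : ℝ) * (1 / 2 * ∑ i, ∑ j, admittanceKernel N ZW i j * (z i - z j) ^ 2)) ∧
        0 < vmin ∧ (∀ k, vmin ≤ vref k) ∧ (∀ k, vref k ≤ vmax) ∧
        (∀ k, (⟨η, α, vref, θ, admittanceKernel N ZW⟩ : DvocReduced N).nodeGainAbs k + α
          < (1 + cos θbar) / 2 * (vmin ^ 2 / vmax ^ 2) * lam - c) :=
  condition2_unsatisfiable_of_not_connectivity ⟨η, α, vref, θ, admittanceKernel N ZW⟩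
    (admittanceKernel_nonneg N ZW) μ (by exact_mod_cast hμ) hμα
    (not_connectivity_certificate_admittance ZW hup hW v μ hsum htest)

end Summit.Ventures.GridStability.Lyapunov
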